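/-
COR-CM (cell pub-hodgecm2, stage 2 of the Hodge ladder) — count-neutral KERNEL COMBINATORICS «the sheared dihedral family», part XV: the blocks of the
slice model and an `s`-invariant signature (seat prover-pub-hodgecm2-b23-g52-0, binder prover b23, gen 52; claim «SYLOW TRANSFER XII + THE SHEARED DIHEDRAL
FAMILY», HOME/INBOX.md l.23708).  gen 44ʼs `Census/QuarticInversionBlocks.lean` for the motions `twH₄`, `twY 0`, `twS`, with a NEW signature (gen 44ʼs
`sigAll` is not `s`-invariant): bookkeeping definitions with bodies (`blockSetoidS`, `BlockS`, `blkS`, `potBS`, `sigAllS`, `sigS`, `invS`) + theorems;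
`decide` only on closed Boolean identities over at most nine Boolean literals; no certificate, no named fact, no `sorry`.  `Interfaces.lean` (C1), every
E term, B01, `Transposition/*`, `PortJoin/*`, `D2Bridge/*` untouched.
HONEST FRAMING: `HC_CM` is NOT proved, here or anywhere in the tree; nothing here is a period, a count of record or a headline.
-/
import Summits.HodgeConjecture.CorCM.Census.ShearedDihedralDescent
import Summits.HodgeConjecture.CorCM.Census.QuarticInversionBlocks

/-!
# The sheared dihedral family, XV: blocks of the `X_n` label model; potential and an `s`-invariant Boolean signature as block invariants

* §1 **The blocks**: classes of labels under the motions `twH₄ g`, `twY 0`, `twS` (reachability by chains of motions, an equivalence since every motion is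
  undone by a chain: `step_revS`); `blkS`, `blkS_twH₄/twY/twS`, the potential of a block `potBS` (gen 44ʼs `pot₄`, `s`-invariant by part X).
* §2 **An `s`-INVARIANT SIGNATURE** `sigAllS (c, h) = (P, Q, R, W, X, V)` of the (class vector, half vector) of a label:
  `P = ⊕ₙ hₙ`, `Q = (h₀ ⊻ h₂) ∧ (h₁ ⊻ h₃)`, `R = P ∧ (h₀ ⊻ h₁)`, `W = ⊕ₙ cₙ·(hₙ ⊻ h_{σT n})`, `X = ⊕ₙ cₙ·(hₙ ⊻ h_{σTσY n} ⊻ [n ≥ 2])`,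
  `V = ⊕ₙ cₙ·(h_{σY n} ⊻ h_{σT n} ⊻ [n ≥ 2])` — blind to a global flip, to `y` (`σY`) and to `s` (`σT` with the mask `bS = {1,3}` of part VI)
  (`sigAllS_flip/_Y/_S`, by `decide` on literals; found by search, `HOME/pub-hodgecm2-b23/SHEARED-DIHEDRAL.md` §3c: the (c,h)-data have 40 orbits under
  these moves and this signature separates the 4 + 8 residual orbits); hence **`invS = (pot₄, sigS)` is a block invariant** (`invS_eq_of_blkS_eq`) — the
  input of the residual-block count (twelve residual blocks) of the X_n column.
All [folklore].

## References
* [Pohlmann1968] H. Pohlmann, Algebraic cycles on abelian varieties of complex multiplication type, Ann. of Math. 88 (1968), Thm 1.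
-/

namespace Summit.HodgeConjecture.CorCM.Census.ShearedDihedral

open Finset
open Summit.HodgeConjecture.CorCM.Census.OddSliceFacesModel
open Summit.HodgeConjecture.CorCM.Census.OddSliceFacesSquares (clsTy clsTy_tw)
open Summit.HodgeConjecture.CorCM.Census.EvenSliceFacesDescent (clsTy_add_one)
open Summit.HodgeConjecture.CorCM.Census.QuarticInversion

noncomputable section

variable (A : Type) [AddCommGroup A] [Fintype A] [DecidableEq A]

/-! ## §1 The blocks of the model -/

omit [Fintype A] [DecidableEq A] in
/-- Every motion is undone by a chain of motions. [folklore] -/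
theorem step_revS {Θ Θ' : Ty₄ A}
    (h : (∃ g : ZMod 2 × A, Θ' = twH₄ A g Θ) ∨ Θ' = twY A 0 Θ ∨ Θ' = twS A Θ) :
    Relation.ReflTransGen (fun Θ₁ Θ₂ : Ty₄ A => (∃ g : ZMod 2 × A, Θ₂ = twH₄ A g Θ₁) ∨ Θ₂ = twY A 0 Θ₁ ∨ Θ₂ = twS A Θ₁) Θ' Θ := by
  rcases h with ⟨g, rfl⟩ | rfl | rfl
  · exact Relation.ReflTransGen.single (Or.inl ⟨-g, by rw [twH₄_twH₄, add_neg_cancel, twH₄_zero]⟩)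
  · refine Relation.ReflTransGen.tail (Relation.ReflTransGen.single (Or.inr (Or.inl rfl))) (Or.inl ⟨-(0, 0), ?_⟩)
    rw [twY_twY, twH₄_twH₄, add_neg_cancel, twH₄_zero]
  · exact Relation.ReflTransGen.single (Or.inr (Or.inr (twS_twS A Θ).symm))

/-- **The block relation** of the `X_n` model: reachability by a chain of motions. [folklore] -/
def blockSetoidS : Setoid (Ty₄ A) where
  r := Relation.ReflTransGen (fun Θ₁ Θ₂ : Ty₄ A => (∃ g : ZMod 2 × A, Θ₂ = twH₄ A g Θ₁) ∨ Θ₂ = twY A 0 Θ₁ ∨ Θ₂ = twS A Θ₁)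
  iseqv := by
    refine ⟨fun _ => Relation.ReflTransGen.refl, fun h => ?_, fun h₁ h₂ => h₁.trans h₂⟩
    induction h with
    | refl => exact Relation.ReflTransGen.refl
    | tail _ hs ih => exact (step_revS A hs).trans ih

/-- **The blocks** of the `X_n` label model. [folklore] -/
def BlockS : Type := Quotient (blockSetoidS A)

/-- The blocks form a finite type. [folklore] -/
noncomputable instance : Fintype (BlockS A) := by
  classical exact Quotient.fintype (blockSetoidS A)

/-- Equality of blocks is decidable (classically). [folklore] -/
noncomputable instance : DecidableEq (BlockS A) := Classical.decEq _

/-- The block of a label. [folklore] -/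
def blkS (Θ : Ty₄ A) : BlockS A := Quotient.mk (blockSetoidS A) Θ

omit [Fintype A] [DecidableEq A] in
/-- Two labels have the same block iff a chain of motions joins them. [folklore] -/
theorem blkS_eq_blkS_iff (Θ Θ' : Ty₄ A) : blkS A Θ = blkS A Θ' ↔
    Relation.ReflTransGen (fun Θ₁ Θ₂ : Ty₄ A => (∃ g : ZMod 2 × A, Θ₂ = twH₄ A g Θ₁) ∨ Θ₂ = twY A 0 Θ₁ ∨ Θ₂ = twS A Θ₁) Θ Θ' :=
  Quotient.eq (r := blockSetoidS A)

omit [Fintype A] [DecidableEq A] in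
/-- Diagonal motions do not change the block. [folklore] -/
theorem blkS_twH₄ (g : ZMod 2 × A) (Θ : Ty₄ A) : blkS A (twH₄ A g Θ) = blkS A Θ :=
  ((blkS_eq_blkS_iff A _ _).mpr (Relation.ReflTransGen.single (Or.inl ⟨g, rfl⟩))).symm

omit [Fintype A] [DecidableEq A] in
/-- `y` does not change the block. [folklore] -/
theorem blkS_twY (Θ : Ty₄ A) : blkS A (twY A 0 Θ) = blkS A Θ :=
  ((blkS_eq_blkS_iff A _ _).mpr (Relation.ReflTransGen.single (Or.inr (Or.inl rfl)))).symm

omit [Fintype A] [DecidableEq A] in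
/-- `s` does not change the block. [folklore] -/
theorem blkS_twS (Θ : Ty₄ A) : blkS A (twS A Θ) = blkS A Θ :=
  ((blkS_eq_blkS_iff A _ _).mpr (Relation.ReflTransGen.single (Or.inr (Or.inr rfl)))).symm

omit [DecidableEq A] in
/-- **The potential is a block invariant.** [folklore] -/
theorem pot₄_eq_of_reachS {Θ Θ' : Ty₄ A}
    (h : Relation.ReflTransGen (fun Θ₁ Θ₂ : Ty₄ A => (∃ g : ZMod 2 × A, Θ₂ = twH₄ A g Θ₁) ∨ Θ₂ = twY A 0 Θ₁ ∨ Θ₂ = twS A Θ₁) Θ Θ') :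
    pot₄ A Θ = pot₄ A Θ' := by
  induction h with
  | refl => rfl
  | tail _ hs ih =>
    rw [ih]
    rcases hs with ⟨g, rfl⟩ | rfl | rfl
    · exact (pot₄_twH₄ A g _).symm
    · exact (pot₄_twY A 0 _).symm
    · exact (pot₄_twS A _).symm

/-- The potential of a block. [folklore] -/
def potBS (B : BlockS A) : ℕ := Quotient.liftOn B (pot₄ A) fun _ _ h => pot₄_eq_of_reachS A h

omit [DecidableEq A] in
/-- `potBS (blkS Θ) = pot₄ Θ`. [folklore] -/
@[simp] theorem potBS_blkS (Θ : Ty₄ A) : potBS A (blkS A Θ) = pot₄ A Θ := rfl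

/-! ## §2 An `s`-invariant Boolean signature -/

/-- **The signature `(P, Q, R, W, X, V)`** of a (class vector, half vector) pair — `s`-, `y`- and flip-invariant (§2). [folklore] -/
def sigAllS (c h : Fin 4 → Bool) : Bool × Bool × Bool × Bool × Bool × Bool :=
  (xor4 h,
   (xor (h 0) (h 2)) && (xor (h 1) (h 3)),
   xor4 h && xor (h 0) (h 1),
   xor4 fun n => c n && xor (h n) (h (σT n)),
   xor4 fun n => c n && xor (xor (h n) (h (σT (σY n)))) (decide (2 ≤ (n : ℕ))),
   xor4 fun n => c n && xor (xor (h (σY n)) (h (σT n))) (decide (2 ≤ (n : ℕ))))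

/-- **The signature is blind to a global flip of the halves.** [folklore] -/
theorem sigAllS_flip (c h : Fin 4 → Bool) (b : Bool) : sigAllS c (fun n => xor (h n) b) = sigAllS c h := by
  cases b <;> exact pat₂_ind (P := fun c h => sigAllS c (fun n => xor (h n) _) = sigAllS c h) (by decide) c h

/-- **The signature is blind to the motion of `y`** (square class `0`: no mask). [folklore] -/
theorem sigAllS_Y (c h : Fin 4 → Bool) :
    sigAllS (fun n => c (σY n)) (fun n => xor (h (σY n)) (bY 0 n)) = sigAllS c h :=
  pat₂_ind (P := fun c h => sigAllS (fun n => c (σY n)) (fun n => xor (h (σY n)) (bY 0 n)) = sigAllS c h) (by decide) c h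

/-- **The signature is blind to the motion of `s`** (mask `bS = {1, 3}`). [folklore] -/
theorem sigAllS_S (c h : Fin 4 → Bool) :
    sigAllS (fun n => c (σT n)) (fun n => xor (h (σT n)) (bS n)) = sigAllS c h :=
  pat₂_ind (P := fun c h => sigAllS (fun n => c (σT n)) (fun n => xor (h (σT n)) (bS n)) = sigAllS c h) (by decide) c h

/-- **The signature of a label.** [folklore] -/
def sigS (Θ : Ty₄ A) : Bool × Bool × Bool × Bool × Bool × Bool := sigAllS (cl A Θ) (hv A Θ)

/-- **The invariant vector** of a label: potential and signature. [folklore] -/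
def invS (Θ : Ty₄ A) : ℕ × (Bool × Bool × Bool × Bool × Bool × Bool) := (pot₄ A Θ, sigS A Θ)

omit [AddCommGroup A] [DecidableEq A] in
/-- Halves under `s`. [folklore] -/
theorem hv_twS (hA : Odd (Fintype.card A)) (Θ : Ty₄ A) : hv A (twS A Θ) = fun n => xor (hv A Θ (σT n)) (bS n) :=
  funext fun n => half_coord_twS A hA Θ n

omit [DecidableEq A] in
/-- Classes of the coordinates under `s`. [folklore] -/
theorem clsTy_coord_twS (Θ : Ty₄ A) (n : Fin 4) : clsTy A (coord A n (twS A Θ)) = clsTy A (coord A (σT n) Θ) := by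
  rw [coord_twS]
  cases bS n
  · rw [show (if false = true then (1 : Ty A) else 0) = 0 from rfl, add_zero]
  · rw [show (if true = true then (1 : Ty A) else 0) = 1 from rfl, clsTy_add_one]

omit [DecidableEq A] in
/-- Classes under `s`. [folklore] -/
theorem cl_twS (Θ : Ty₄ A) : cl A (twS A Θ) = fun n => cl A Θ (σT n) := by
  funext n; unfold cl; rw [clsTy_coord_twS]

omit [DecidableEq A] in
/-- **The signature is preserved by `H₀`.** [folklore] -/
theorem sigS_twH₄ (hA : Odd (Fintype.card A)) (g : ZMod 2 × A) (Θ : Ty₄ A) : sigS A (twH₄ A g Θ) = sigS A Θ := by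
  unfold sigS; rw [hv_twH₄ A hA, cl_twH₄, sigAllS_flip]

omit [DecidableEq A] in
/-- **The signature is preserved by `y`.** [folklore] -/
theorem sigS_twY (hA : Odd (Fintype.card A)) (Θ : Ty₄ A) : sigS A (twY A 0 Θ) = sigS A Θ := by
  unfold sigS; rw [hv_twY A 0 hA, cl_twY, sigAllS_Y]

omit [DecidableEq A] in
/-- **The signature is preserved by `s`.** [folklore] -/
theorem sigS_twS (hA : Odd (Fintype.card A)) (Θ : Ty₄ A) : sigS A (twS A Θ) = sigS A Θ := by
  unfold sigS; rw [hv_twS A hA, cl_twS, sigAllS_S]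

omit [DecidableEq A] in
/-- **The invariant vector is constant along chains of motions.** [folklore] -/
theorem invS_eq_of_reachS (hA : Odd (Fintype.card A)) {Θ Θ' : Ty₄ A}
    (h : Relation.ReflTransGen (fun Θ₁ Θ₂ : Ty₄ A => (∃ g : ZMod 2 × A, Θ₂ = twH₄ A g Θ₁) ∨ Θ₂ = twY A 0 Θ₁ ∨ Θ₂ = twS A Θ₁) Θ Θ') :
    invS A Θ = invS A Θ' := by
  induction h with
  | refl => rfl
  | tail _ hs ih =>
    rw [ih]
    rcases hs with ⟨g, rfl⟩ | rfl | rfl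
    · unfold invS; rw [pot₄_twH₄, sigS_twH₄ A hA]
    · unfold invS; rw [pot₄_twY, sigS_twY A hA]
    · unfold invS; rw [pot₄_twS, sigS_twS A hA]

omit [DecidableEq A] in
/-- **Labels in the same block have the same invariant vector.** [folklore] -/
theorem invS_eq_of_blkS_eq (hA : Odd (Fintype.card A)) {Θ Θ' : Ty₄ A} (h : blkS A Θ = blkS A Θ') : invS A Θ = invS A Θ' :=
  invS_eq_of_reachS A hA ((blkS_eq_blkS_iff A Θ Θ').mp h)

omit [DecidableEq A] in
/-- Labels with different invariant vectors lie in different blocks. [folklore] -/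
theorem blkS_ne_of_invS_ne (hA : Odd (Fintype.card A)) {Θ Θ' : Ty₄ A} (h : invS A Θ ≠ invS A Θ') : blkS A Θ ≠ blkS A Θ' :=
  fun e => h (invS_eq_of_blkS_eq A hA e)

end

end Summit.HodgeConjecture.CorCM.Census.ShearedDihedral
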